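import Summits.Ventures.YMGap.Thresholds.ZeroCouplingResampling
import Summits.Ventures.YMGap.Thresholds.HaarFourthMoment
import HarnessLib

/-!
# `SU(2)` plaquette moments of order `≤ 4` under the infinite Haar product `dg_∞` (THE DLR state at `β = 0`): all third
# moments vanish and the joint fourth cumulant is `κ₄(W_p, W_q, W_r, W_s) = −δ_{p=q=r=s}/16`
# (row type C-PRESS, endpoint `β = 0`, part 11b)

Cell `pub-ymgap`, seat ds-1 (gen 11). HONEST FRAMING: exact strong-coupling LATTICE statements AT `β = 0` for `SU(2)` Wilson
lattice gauge theory on `ℤ^d` (any `d`): moments of the plaquette variables `W_p = ½ Re tr U_p` under the product Haar measure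
`zdHaar d G` for a compact group `G ≅ SU(2)`; nothing about `β > 0`, nothing about the continuum or the Clay problem. Kernel
theorems only, 0 compute, no definitions.

With part 10 (`HaarFourthMoment`: `∫ (½Re tr)⁴ dHaar = 1/8`, `∫ (Re tr)³ dHaar = 0`, `∫ (Re tr)² dHaar = 1`) and part 11a
(`ZeroCouplingResampling`: a plaquette of multiplicity one kills the moment; `∫ W_p²W_q² = (V₀/N²)²`):
* `∫ W_p⁴ dg_∞ = 1/8`, `∫ W_p³ dg_∞ = 0`, `∫ W_p W_q dg_∞ = δ_{pq}/4`, `∫ W_p²W_q² dg_∞ = 1/16` (`p ≠ q`) in every ordering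
  (`su2_integral_four/cube/mul/pair₁₂/pair₁₃/pair₁₄_zdHaar`), the single-occurrence vanishing in each of the four positions
  (`su2_integral_single₁…₄_zdHaar`, `su2_integral_third_single_zdHaar`);
* ★ ALL third moments vanish: `∫ W_a W_b W_c dg_∞ = 0` (`su2_integral_mul₂_zdHaar`);
* ★★ THE FOURTH MOMENTS: `∫ W_a W_b W_c W_e dg_∞ = (δ_{ab}δ_{ce} + δ_{ac}δ_{be} + δ_{ae}δ_{bc} − δ_{a=b=c=e})/16`
  (`su2_integral_mul₃_zdHaar`) — Wick pairing with `E W_aW_b = δ_{ab}/4`, corrected on the diagonal by the semicircle excess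
  `E W⁴ − 3(E W²)² = 1/8 − 3/16`; equivalently ★★ THE JOINT FOURTH CUMULANT `κ₄ = −δ_{a=b=c=e}/16` (`su2_fourthCumulant_zdHaar`);
  venture-vocabulary instances for `fundamentalRep (Fin 2)` (`…_fundamental`).
USE (part 12, staged behind the g10 C⁴ chain `PressureFourthDerivative(TwoSided)`): for `SU(2)` on `ℤ⁴`,
`f⁗(0) = Σ_{i<j} 16 Σ_{q,r,s} κ₄(W_{p_ij}, W_q, W_r, W_s) = 6 · 16 · (−1/16) = −6` — the fourth Balian–Drouffe–Itzykson
coefficient of the strong-coupling free energy density (`g(β_W) = f(β_W/2) = … − (1/64)β_W⁴ + o(β_W⁴)`, i.e. `−6 log(2I₁(β_W)/β_W)`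
through order 4). References: Balian–Drouffe–Itzykson, Phys. Rev. D 11 (1975) 2104 §III; Osterwalder–Seiler, Ann. Phys. 110
(1978) 440 §3. Everything here is proved. [folklore]
-/

noncomputable section

open MeasureTheory ProbabilityTheory Finset
open Literature.MathematicalPhysics.QuantumLattice (ZdPlaquette plaquetteEdges fundamentalRep plaquetteObs)
open Literature.MathematicalPhysics.QuantumFieldTheory hiding ZdEdge
open Literature.Probability.LatticeModels (Site)

namespace Summit.Ventures.YMGap.ZeroCouplingMoments

/-! ## C. `SU(2)`: all plaquette moments of order `≤ 4` at `β = 0`, and the fourth cumulant -/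

section SU2

open Literature.MathematicalPhysics.QuantumFieldTheory.PlaquetteLowerBound (reTr charVariance)

variable {d : ℕ} {G : Type*} [Group G] [TopologicalSpace G] [IsTopologicalGroup G] [CompactSpace G]
  [MeasurableSpace G] [BorelSpace G] [SecondCountableTopology G] {ρ : G →* Matrix (Fin 2) (Fin 2) ℂ}

/-- Shorthand for this section: the `SU(2)` plaquette variable `W_p = ½ Re tr U_p` on `ℤ^d`. -/
local notation3 (prettyPrint := false) "𝔚" => fun (p : ZdPlaquette d) (U : ZdGaugeConfig d G) =>
  zdPlaquetteObs ρ p.1 p.2.1.1 p.2.1.2 U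

/-- `SU(2)`: `∫ W_p W_p W_p W_p dg_∞ = 1/8`. [folklore] -/
theorem su2_integral_four_zdHaar (hρ : IsSpecialUnitaryModel ρ) (p : ZdPlaquette d) :
    ∫ U, 𝔚 p U * 𝔚 p U * 𝔚 p U * 𝔚 p U ∂zdHaar d G = 1 / 8 := by
  have h := integral_pow_four_zdHaar (d := d) (G := G) hρ.1 p
  simp only [Nat.cast_ofNat] at h
  rw [HaarFourthMoment.integral_half_reTr_pow_four ρ hρ] at h
  exact (integral_congr_ae (Filter.Eventually.of_forall fun U => by ring)).trans h

/-- `SU(2)`: `∫ W_p W_p W_p dg_∞ = 0`. [folklore] -/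
theorem su2_integral_cube_zdHaar (hρ : IsSpecialUnitaryModel ρ) (p : ZdPlaquette d) :
    ∫ U, 𝔚 p U * 𝔚 p U * 𝔚 p U ∂zdHaar d G = 0 := by
  have h := integral_pow_three_zdHaar (d := d) (G := G) hρ.1 p
  simp_rw [mul_pow] at h
  rw [integral_const_mul, HaarFourthMoment.integral_reTr_pow_three ρ hρ, mul_zero] at h
  exact (integral_congr_ae (Filter.Eventually.of_forall fun U => by ring)).trans h

/-- `SU(2)`: `∫ W_p W_q dg_∞ = δ_{pq}/4`. [folklore] -/
theorem su2_integral_mul_zdHaar (hρ : IsSpecialUnitaryModel ρ) (p q : ZdPlaquette d) :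
    ∫ U, 𝔚 p U * 𝔚 q U ∂zdHaar d G = if p = q then 1 / 4 else 0 := by
  show ∫ U, zdPlaquetteObs ρ p.1 p.2.1.1 p.2.1.2 U * zdPlaquetteObs ρ q.1 q.2.1.1 q.2.1.2 U ∂zdHaar d G = _
  rw [integral_mul_zdHaar hρ le_rfl, RobustBall.HaarSecondMoments.charVariance_eq_one ρ hρ]
  norm_num

/-- `SU(2)`, `p ≠ q`: `∫ W_p W_p W_q W_q dg_∞ = 1/16`. [folklore] -/
theorem su2_integral_pair₁₂_zdHaar (hρ : IsSpecialUnitaryModel ρ) {p q : ZdPlaquette d} (hpq : p ≠ q) :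
    ∫ U, 𝔚 p U * 𝔚 p U * 𝔚 q U * 𝔚 q U ∂zdHaar d G = 1 / 16 := by
  have h := integral_sq_mul_sq_zdHaar (d := d) (G := G) hρ hpq
  rw [RobustBall.HaarSecondMoments.charVariance_eq_one ρ hρ] at h
  norm_num at h
  exact (integral_congr_ae (Filter.Eventually.of_forall fun U => by ring)).trans h

/-- `SU(2)`, `p ≠ q`: `∫ W_p W_q W_p W_q dg_∞ = 1/16`. [folklore] -/
theorem su2_integral_pair₁₃_zdHaar (hρ : IsSpecialUnitaryModel ρ) {p q : ZdPlaquette d} (hpq : p ≠ q) :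
    ∫ U, 𝔚 p U * 𝔚 q U * 𝔚 p U * 𝔚 q U ∂zdHaar d G = 1 / 16 :=
  (integral_congr_ae (Filter.Eventually.of_forall fun U => by ring)).trans (su2_integral_pair₁₂_zdHaar hρ hpq)

/-- `SU(2)`, `p ≠ q`: `∫ W_p W_q W_q W_p dg_∞ = 1/16`. [folklore] -/
theorem su2_integral_pair₁₄_zdHaar (hρ : IsSpecialUnitaryModel ρ) {p q : ZdPlaquette d} (hpq : p ≠ q) :
    ∫ U, 𝔚 p U * 𝔚 q U * 𝔚 q U * 𝔚 p U ∂zdHaar d G = 1 / 16 :=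
  (integral_congr_ae (Filter.Eventually.of_forall fun U => by ring)).trans (su2_integral_pair₁₂_zdHaar hρ hpq)

/-- A plaquette occurring exactly once, in position 1 of a fourth moment, kills it. [folklore] -/
theorem su2_integral_single₁_zdHaar (hρ : IsSpecialUnitaryModel ρ) {s p q r : ZdPlaquette d} (hp : s ≠ p)
    (hq : s ≠ q) (hr : s ≠ r) : ∫ U, 𝔚 s U * 𝔚 p U * 𝔚 q U * 𝔚 r U ∂zdHaar d G = 0 :=
  (integral_congr_ae (Filter.Eventually.of_forall fun U => by ring)).trans
    (integral_mul₃_eq_zero_of_ne (d := d) (G := G) hρ le_rfl hp hq hr)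

/-- A plaquette occurring exactly once, in position 2 of a fourth moment, kills it. [folklore] -/
theorem su2_integral_single₂_zdHaar (hρ : IsSpecialUnitaryModel ρ) {s p q r : ZdPlaquette d} (hp : s ≠ p)
    (hq : s ≠ q) (hr : s ≠ r) : ∫ U, 𝔚 p U * 𝔚 s U * 𝔚 q U * 𝔚 r U ∂zdHaar d G = 0 :=
  (integral_congr_ae (Filter.Eventually.of_forall fun U => by ring)).trans
    (integral_mul₃_eq_zero_of_ne (d := d) (G := G) hρ le_rfl hp hq hr)

/-- A plaquette occurring exactly once, in position 3 of a fourth moment, kills it. [folklore] -/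
theorem su2_integral_single₃_zdHaar (hρ : IsSpecialUnitaryModel ρ) {s p q r : ZdPlaquette d} (hp : s ≠ p)
    (hq : s ≠ q) (hr : s ≠ r) : ∫ U, 𝔚 p U * 𝔚 q U * 𝔚 s U * 𝔚 r U ∂zdHaar d G = 0 :=
  (integral_congr_ae (Filter.Eventually.of_forall fun U => by ring)).trans
    (integral_mul₃_eq_zero_of_ne (d := d) (G := G) hρ le_rfl hp hq hr)

/-- A plaquette occurring exactly once, in position 4 of a fourth moment, kills it. [folklore] -/
theorem su2_integral_single₄_zdHaar (hρ : IsSpecialUnitaryModel ρ) {s p q r : ZdPlaquette d} (hp : s ≠ p)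
    (hq : s ≠ q) (hr : s ≠ r) : ∫ U, 𝔚 p U * 𝔚 q U * 𝔚 r U * 𝔚 s U ∂zdHaar d G = 0 :=
  (integral_congr_ae (Filter.Eventually.of_forall fun U => by ring)).trans
    (integral_mul₃_eq_zero_of_ne (d := d) (G := G) hρ le_rfl hp hq hr)

/-- A plaquette occurring exactly once in a third moment kills it (positions 1, 2, 3). [folklore] -/
theorem su2_integral_third_single_zdHaar (hρ : IsSpecialUnitaryModel ρ) {s p q : ZdPlaquette d} (hp : s ≠ p)
    (hq : s ≠ q) :
    ∫ U, 𝔚 s U * 𝔚 p U * 𝔚 q U ∂zdHaar d G = 0 ∧ ∫ U, 𝔚 p U * 𝔚 s U * 𝔚 q U ∂zdHaar d G = 0 ∧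
      ∫ U, 𝔚 p U * 𝔚 q U * 𝔚 s U ∂zdHaar d G = 0 := by
  have h := integral_mul₂_eq_zero_of_ne (d := d) (G := G) hρ le_rfl hp hq
  exact ⟨(integral_congr_ae (Filter.Eventually.of_forall fun U => by ring)).trans h,
    (integral_congr_ae (Filter.Eventually.of_forall fun U => by ring)).trans h,
    (integral_congr_ae (Filter.Eventually.of_forall fun U => by ring)).trans h⟩

/-- ★ **`SU(2)`: EVERY third plaquette moment vanishes at `β = 0`**, `∫ W_a W_b W_c dg_∞ = 0` (all equal: `∫ W³ dHaar = 0`;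
otherwise some plaquette occurs exactly once). [folklore] -/
theorem su2_integral_mul₂_zdHaar (hρ : IsSpecialUnitaryModel ρ) (a b c : ZdPlaquette d) :
    ∫ U, 𝔚 a U * 𝔚 b U * 𝔚 c U ∂zdHaar d G = 0 := by
  by_cases hab : a = b
  · subst hab
    by_cases hac : a = c
    · subst hac
      exact su2_integral_cube_zdHaar hρ a
    · exact (su2_integral_third_single_zdHaar hρ (Ne.symm hac) (Ne.symm hac)).2.2
  · by_cases hac : a = c
    · subst hac
      exact (su2_integral_third_single_zdHaar hρ (Ne.symm hab) (Ne.symm hab)).2.1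
    · exact (su2_integral_third_single_zdHaar hρ hab hac).1

/-- ★★ **`SU(2)`: THE FOURTH PLAQUETTE MOMENTS AT `β = 0`**:
`∫ W_a W_b W_c W_e dg_∞ = (δ_{ab}δ_{ce} + δ_{ac}δ_{be} + δ_{ae}δ_{bc} − δ_{a=b=c=e})/16` — the Gaussian (Wick) pairing rule
with `E W_aW_b = δ_{ab}/4`, corrected on the diagonal by the single-plaquette excess `E W⁴ − 3(E W²)² = 1/8 − 3/16`.
[folklore] -/
theorem su2_integral_mul₃_zdHaar (hρ : IsSpecialUnitaryModel ρ) (a b c e : ZdPlaquette d) :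
    ∫ U, 𝔚 a U * 𝔚 b U * 𝔚 c U * 𝔚 e U ∂zdHaar d G =
      ((if a = b ∧ c = e then 1 else 0) + (if a = c ∧ b = e then 1 else 0) + (if a = e ∧ b = c then 1 else 0) -
        (if a = b ∧ a = c ∧ a = e then 1 else 0)) / 16 := by
  by_cases hab : a = b
  · subst hab
    by_cases hac : a = c
    · subst hac
      by_cases hae : a = e
      · subst hae
        rw [su2_integral_four_zdHaar hρ a]; norm_num
      · rw [su2_integral_single₄_zdHaar hρ (Ne.symm hae) (Ne.symm hae) (Ne.symm hae)]; norm_num [hae]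
    · by_cases hae : a = e
      · subst hae
        rw [su2_integral_single₃_zdHaar hρ (Ne.symm hac) (Ne.symm hac) (Ne.symm hac)]; norm_num [hac, Ne.symm hac]
      · by_cases hce : c = e
        · subst hce
          rw [su2_integral_pair₁₂_zdHaar hρ hac]; norm_num [hac]
        · rw [su2_integral_single₃_zdHaar hρ (Ne.symm hac) (Ne.symm hac) hce]; norm_num [hac, hae, hce]
  · by_cases hac : a = c
    · subst hac
      by_cases hae : a = e
      · subst hae
        rw [su2_integral_single₂_zdHaar hρ (Ne.symm hab) (Ne.symm hab) (Ne.symm hab)]; norm_num [hab, Ne.symm hab]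
      · by_cases hbe : b = e
        · subst hbe
          rw [su2_integral_pair₁₃_zdHaar hρ hab]; norm_num [hab]
        · rw [su2_integral_single₂_zdHaar hρ (Ne.symm hab) (Ne.symm hab) hbe]; norm_num [hab, hae, hbe]
    · by_cases hae : a = e
      · subst hae
        by_cases hbc : b = c
        · subst hbc
          rw [su2_integral_pair₁₄_zdHaar hρ hab]; norm_num [hab]
        · rw [su2_integral_single₂_zdHaar hρ (Ne.symm hab) hbc (Ne.symm hab)]; norm_num [hab, hac, hbc]
      · rw [su2_integral_single₁_zdHaar hρ hab hac hae]; norm_num [hab, hac, hae]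

/-- ★★ **`SU(2)`: THE JOINT FOURTH CUMULANT OF THE PLAQUETTE VARIABLES AT `β = 0`**:
`κ₄(W_a, W_b, W_c, W_e) = E[abce] − E[ab]E[ce] − E[ac]E[be] − E[ae]E[bc] = −δ_{a=b=c=e}/16` (all first and third
moments vanish, so this is the full cumulant): the plaquette variables are an orthogonal family, independent across
plaquettes up to order four, with the semicircle excess kurtosis on the diagonal. [folklore] -/
theorem su2_fourthCumulant_zdHaar (hρ : IsSpecialUnitaryModel ρ) (a b c e : ZdPlaquette d) :
    ∫ U, 𝔚 a U * 𝔚 b U * 𝔚 c U * 𝔚 e U ∂zdHaar d G -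
        (∫ U, 𝔚 a U * 𝔚 b U ∂zdHaar d G) * (∫ U, 𝔚 c U * 𝔚 e U ∂zdHaar d G) -
        (∫ U, 𝔚 a U * 𝔚 c U ∂zdHaar d G) * (∫ U, 𝔚 b U * 𝔚 e U ∂zdHaar d G) -
        (∫ U, 𝔚 a U * 𝔚 e U ∂zdHaar d G) * (∫ U, 𝔚 b U * 𝔚 c U ∂zdHaar d G) =
      -(if a = b ∧ a = c ∧ a = e then 1 else 0) / 16 := by
  have key : ∀ (P Q : Prop) [Decidable P] [Decidable Q],
      ((if P then (1 / 4 : ℝ) else 0) * (if Q then (1 / 4 : ℝ) else 0)) = if P ∧ Q then 1 / 16 else 0 := by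
    intro P Q _ _
    by_cases hP : P <;> by_cases hQ : Q <;> norm_num [hP, hQ]
  rw [su2_integral_mul₃_zdHaar hρ, su2_integral_mul_zdHaar hρ, su2_integral_mul_zdHaar hρ, su2_integral_mul_zdHaar hρ,
    su2_integral_mul_zdHaar hρ, su2_integral_mul_zdHaar hρ, su2_integral_mul_zdHaar hρ, key, key, key]
  split_ifs <;> norm_num

end SU2

/-! ## C′. `SU(2)`, every `d`: the connected three- and four-point functions of plaquette variables at `β = 0` -/

section Cumulants

variable {d : ℕ} {G : Type*} [Group G] [TopologicalSpace G] [IsTopologicalGroup G] [CompactSpace G]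
  [MeasurableSpace G] [BorelSpace G] [SecondCountableTopology G] {ρ : G →* Matrix (Fin 2) (Fin 2) ℂ}

/-- Shorthand for this section: the `SU(2)` plaquette variable `W_p = ½ Re tr U_p` on `ℤ^d`. -/
local notation3 (prettyPrint := false) "𝔚" => fun (p : ZdPlaquette d) (U : ZdGaugeConfig d G) =>
  zdPlaquetteObs ρ p.1 p.2.1.1 p.2.1.2 U

/-- Local shorthand: the connected three-point function `u₃(X; Y; Z)` under `μ` (the tree's spelled-out form, g10 file A). -/
local notation3 (prettyPrint := false) "U₃[" X ";" Y ";" Z ";" μ "]" =>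
  cov[fun ω => X ω * Y ω, Z; μ] - (∫ ω, X ω ∂μ) * cov[Y, Z; μ] - (∫ ω, Y ω ∂μ) * cov[X, Z; μ]

/-- Local shorthand: the connected four-point function in derivative form `u₄(X; Y; Z; W)` under `μ` (g10 file G). -/
local notation3 (prettyPrint := false) "U₄[" X ";" Y ";" Z ";" W ";" μ "]" =>
  (cov[fun ω => (X ω * Y ω) * Z ω, W; μ] - (∫ ω, X ω * Y ω ∂μ) * cov[Z, W; μ] - (∫ ω, Z ω ∂μ) * cov[fun ω => X ω * Y ω, W; μ])
  - cov[X, W; μ] * cov[Y, Z; μ] - (∫ ω, X ω ∂μ) * U₃[Y ; Z ; W ; μ]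
  - cov[Y, W; μ] * cov[X, Z; μ] - (∫ ω, Y ω ∂μ) * U₃[X ; Z ; W ; μ]

omit [CompactSpace G] in
/-- Measurability and the bound `|W_p| ≤ 1` of the plaquette variables, and of their products. [folklore] -/
theorem su2_zdPlaquetteObs_data (hρ : IsSpecialUnitaryModel ρ) (a b c : ZdPlaquette d) :
    (Measurable (𝔚 a) ∧ ∀ U, |𝔚 a U| ≤ 1) ∧
      (Measurable (fun U => 𝔚 a U * 𝔚 b U) ∧ ∀ U, |𝔚 a U * 𝔚 b U| ≤ 1) ∧
      (Measurable (fun U => 𝔚 a U * 𝔚 b U * 𝔚 c U) ∧ ∀ U, |𝔚 a U * 𝔚 b U * 𝔚 c U| ≤ 1) := by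
  have hm : ∀ r : ZdPlaquette d, Measurable (𝔚 r) := fun r => (continuous_zdPlaquetteObs (d := d) hρ.1 r).measurable
  have hb : ∀ (r : ZdPlaquette d) (U : ZdGaugeConfig d G), |𝔚 r U| ≤ 1 := fun r U =>
    abs_zdPlaquetteObs_le (IsSpecialUnitaryModel.mem_unitaryGroup ρ hρ) _ _ _ U
  have hb2 : ∀ U, |𝔚 a U * 𝔚 b U| ≤ 1 := fun U => by
    rw [abs_mul]
    calc |𝔚 a U| * |𝔚 b U| ≤ 1 * 1 := mul_le_mul (hb a U) (hb b U) (abs_nonneg _) zero_le_one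
      _ = 1 := one_mul 1
  refine ⟨⟨hm a, hb a⟩, ⟨(hm a).mul (hm b), hb2⟩, ⟨((hm a).mul (hm b)).mul (hm c), fun U => ?_⟩⟩
  rw [abs_mul]
  calc |𝔚 a U * 𝔚 b U| * |𝔚 c U| ≤ 1 * 1 := mul_le_mul (hb2 U) (hb c U) (abs_nonneg _) zero_le_one
    _ = 1 := one_mul 1

/-- ★ **`SU(2)`, every `d`: the connected three-point function of plaquette variables VANISHES at `β = 0`**,
`u₃(W_a; W_b; W_c)|_{dg_∞} = 0` (all first and third moments vanish). This extends g10's `d = 4` statement `su2_threePoint_zero`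
(proved there by the coupling-sign flip) to every dimension, by direct evaluation. [folklore] -/
theorem su2_threePoint_zdHaar (hρ : IsSpecialUnitaryModel ρ) (a b c : ZdPlaquette d) :
    U₃[𝔚 a ; 𝔚 b ; 𝔚 c ; zdHaar d G] = 0 := by
  obtain ⟨⟨hma, hba⟩, ⟨hmab, hbab⟩, -⟩ := su2_zdPlaquetteObs_data (d := d) (G := G) hρ a b c
  obtain ⟨⟨hmc, hbc⟩, -, -⟩ := su2_zdPlaquetteObs_data (d := d) (G := G) hρ c a a
  have h0 : ∀ r : ZdPlaquette d, ∫ U, 𝔚 r U ∂zdHaar d G = 0 := fun r =>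
    PressureRegularity.integral_zdPlaquetteObs_zdHaar hρ le_rfl r
  rw [CouplingResponse.covariance_eq_sub_of_abs_le hmab hmc hbab hbc, h0 a, h0 b, h0 c, su2_integral_mul₂_zdHaar hρ a b c]
  ring

/-- ★★ **`SU(2)`, every `d`: the connected four-point function of plaquette variables at `β = 0`**,
`u₄(W_a; W_b; W_c; W_e)|_{dg_∞} = −δ_{a=b=c=e}/16` (it reduces to the fourth cumulant of part C since all first and third
moments vanish). [folklore] -/
theorem su2_fourPoint_zdHaar (hρ : IsSpecialUnitaryModel ρ) (a b c e : ZdPlaquette d) :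
    U₄[𝔚 a ; 𝔚 b ; 𝔚 c ; 𝔚 e ; zdHaar d G] = -(if a = b ∧ a = c ∧ a = e then 1 else 0) / 16 := by
  classical
  obtain ⟨⟨hma, hba⟩, ⟨hmab, hbab⟩, ⟨hmabc, hbabc⟩⟩ := su2_zdPlaquetteObs_data (d := d) (G := G) hρ a b c
  obtain ⟨⟨hmb, hbb⟩, ⟨hmbc, hbbc⟩, -⟩ := su2_zdPlaquetteObs_data (d := d) (G := G) hρ b c c
  obtain ⟨⟨hmc, hbc⟩, ⟨hmce, hbce⟩, -⟩ := su2_zdPlaquetteObs_data (d := d) (G := G) hρ c e e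
  obtain ⟨⟨hme, hbe⟩, -, -⟩ := su2_zdPlaquetteObs_data (d := d) (G := G) hρ e e e
  obtain ⟨-, ⟨hmac, hbac⟩, -⟩ := su2_zdPlaquetteObs_data (d := d) (G := G) hρ a c c
  obtain ⟨-, ⟨hmae, hbae⟩, -⟩ := su2_zdPlaquetteObs_data (d := d) (G := G) hρ a e e
  obtain ⟨-, ⟨hmbe, hbbe⟩, -⟩ := su2_zdPlaquetteObs_data (d := d) (G := G) hρ b e e
  have h0 : ∀ r : ZdPlaquette d, ∫ U, 𝔚 r U ∂zdHaar d G = 0 := fun r =>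
    PressureRegularity.integral_zdPlaquetteObs_zdHaar hρ le_rfl r
  have h3 := su2_threePoint_zdHaar (d := d) (G := G) hρ
  have h4 := su2_fourthCumulant_zdHaar (d := d) (G := G) hρ a b c e
  simp only [h3, mul_zero, sub_zero]
  rw [CouplingResponse.covariance_eq_sub_of_abs_le hmabc hme hbabc hbe,
    CouplingResponse.covariance_eq_sub_of_abs_le hmc hme hbc hbe,
    CouplingResponse.covariance_eq_sub_of_abs_le hmab hme hbab hbe,
    CouplingResponse.covariance_eq_sub_of_abs_le hma hme hba hbe,
    CouplingResponse.covariance_eq_sub_of_abs_le hmb hmc hbb hbc,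
    CouplingResponse.covariance_eq_sub_of_abs_le hmb hme hbb hbe,
    CouplingResponse.covariance_eq_sub_of_abs_le hma hmc hba hbc, h0 a, h0 b, h0 c, h0 e,
    su2_integral_mul₂_zdHaar hρ a b c]
  linear_combination h4

end Cumulants

/-! ## D. The concrete group `SU(2) = Matrix.specialUnitaryGroup (Fin 2) ℂ` -/

section Concrete

open Literature.MathematicalPhysics.QuantumFieldTheory.TorusAreaLaw (isSpecialUnitaryModel_fundamentalRep)

variable {d : ℕ}

/-- ★★ **`SU(2)` on `ℤ^d`, `β = 0`: every third plaquette moment vanishes** (venture vocabulary `fundamentalRep (Fin 2)`).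
[folklore] -/
theorem su2_integral_mul₂_zdHaar_fundamental (a b c : ZdPlaquette d) :
    ∫ U, zdPlaquetteObs (fundamentalRep (Fin 2)) a.1 a.2.1.1 a.2.1.2 U *
        zdPlaquetteObs (fundamentalRep (Fin 2)) b.1 b.2.1.1 b.2.1.2 U *
        zdPlaquetteObs (fundamentalRep (Fin 2)) c.1 c.2.1.1 c.2.1.2 U
      ∂zdHaar d (Matrix.specialUnitaryGroup (Fin 2) ℂ) = 0 := by
  haveI := Literature.MathematicalPhysics.QuantumLattice.secondCountableTopology_su2
  exact su2_integral_mul₂_zdHaar (isSpecialUnitaryModel_fundamentalRep 2) a b c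

/-- ★★ **`SU(2)` on `ℤ^d`, `β = 0`: the fourth plaquette moments** (venture vocabulary). [folklore] -/
theorem su2_integral_mul₃_zdHaar_fundamental (a b c e : ZdPlaquette d) :
    ∫ U, zdPlaquetteObs (fundamentalRep (Fin 2)) a.1 a.2.1.1 a.2.1.2 U *
        zdPlaquetteObs (fundamentalRep (Fin 2)) b.1 b.2.1.1 b.2.1.2 U *
        zdPlaquetteObs (fundamentalRep (Fin 2)) c.1 c.2.1.1 c.2.1.2 U *
        zdPlaquetteObs (fundamentalRep (Fin 2)) e.1 e.2.1.1 e.2.1.2 U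
      ∂zdHaar d (Matrix.specialUnitaryGroup (Fin 2) ℂ) =
      ((if a = b ∧ c = e then 1 else 0) + (if a = c ∧ b = e then 1 else 0) + (if a = e ∧ b = c then 1 else 0) -
        (if a = b ∧ a = c ∧ a = e then 1 else 0)) / 16 := by
  haveI := Literature.MathematicalPhysics.QuantumLattice.secondCountableTopology_su2
  exact su2_integral_mul₃_zdHaar (isSpecialUnitaryModel_fundamentalRep 2) a b c e

/-- ★★ **`SU(2)` on `ℤ^d`, `β = 0`: the joint fourth cumulant of the plaquette variables is `−δ_{a=b=c=e}/16`**
(venture vocabulary). [folklore] -/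
theorem su2_fourthCumulant_zdHaar_fundamental (a b c e : ZdPlaquette d) :
    ∫ U, zdPlaquetteObs (fundamentalRep (Fin 2)) a.1 a.2.1.1 a.2.1.2 U *
        zdPlaquetteObs (fundamentalRep (Fin 2)) b.1 b.2.1.1 b.2.1.2 U *
        zdPlaquetteObs (fundamentalRep (Fin 2)) c.1 c.2.1.1 c.2.1.2 U *
        zdPlaquetteObs (fundamentalRep (Fin 2)) e.1 e.2.1.1 e.2.1.2 U ∂zdHaar d (Matrix.specialUnitaryGroup (Fin 2) ℂ) -
      (∫ U, zdPlaquetteObs (fundamentalRep (Fin 2)) a.1 a.2.1.1 a.2.1.2 U *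
        zdPlaquetteObs (fundamentalRep (Fin 2)) b.1 b.2.1.1 b.2.1.2 U ∂zdHaar d (Matrix.specialUnitaryGroup (Fin 2) ℂ)) *
      (∫ U, zdPlaquetteObs (fundamentalRep (Fin 2)) c.1 c.2.1.1 c.2.1.2 U *
        zdPlaquetteObs (fundamentalRep (Fin 2)) e.1 e.2.1.1 e.2.1.2 U ∂zdHaar d (Matrix.specialUnitaryGroup (Fin 2) ℂ)) -
      (∫ U, zdPlaquetteObs (fundamentalRep (Fin 2)) a.1 a.2.1.1 a.2.1.2 U *
        zdPlaquetteObs (fundamentalRep (Fin 2)) c.1 c.2.1.1 c.2.1.2 U ∂zdHaar d (Matrix.specialUnitaryGroup (Fin 2) ℂ)) *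
      (∫ U, zdPlaquetteObs (fundamentalRep (Fin 2)) b.1 b.2.1.1 b.2.1.2 U *
        zdPlaquetteObs (fundamentalRep (Fin 2)) e.1 e.2.1.1 e.2.1.2 U ∂zdHaar d (Matrix.specialUnitaryGroup (Fin 2) ℂ)) -
      (∫ U, zdPlaquetteObs (fundamentalRep (Fin 2)) a.1 a.2.1.1 a.2.1.2 U *
        zdPlaquetteObs (fundamentalRep (Fin 2)) e.1 e.2.1.1 e.2.1.2 U ∂zdHaar d (Matrix.specialUnitaryGroup (Fin 2) ℂ)) *
      (∫ U, zdPlaquetteObs (fundamentalRep (Fin 2)) b.1 b.2.1.1 b.2.1.2 U *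
        zdPlaquetteObs (fundamentalRep (Fin 2)) c.1 c.2.1.1 c.2.1.2 U ∂zdHaar d (Matrix.specialUnitaryGroup (Fin 2) ℂ)) =
      -(if a = b ∧ a = c ∧ a = e then 1 else 0) / 16 := by
  haveI := Literature.MathematicalPhysics.QuantumLattice.secondCountableTopology_su2
  exact su2_fourthCumulant_zdHaar (isSpecialUnitaryModel_fundamentalRep 2) a b c e

/-- Local shorthand (concrete group): the connected three-point function under `μ`. -/
local notation3 (prettyPrint := false) "U₃'[" X ";" Y ";" Z ";" μ "]" =>
  cov[fun ω => X ω * Y ω, Z; μ] - (∫ ω, X ω ∂μ) * cov[Y, Z; μ] - (∫ ω, Y ω ∂μ) * cov[X, Z; μ]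

/-- ★★ **`SU(2)` on `ℤ^d`, `β = 0`: the connected four-point function of plaquette variables is `−δ_{a=b=c=e}/16`**
(venture vocabulary `fundamentalRep (Fin 2)`, g10's derivative form spelled out). [folklore] -/
theorem su2_fourPoint_zdHaar_fundamental (a b c e : ZdPlaquette d) :
    (cov[fun U => (zdPlaquetteObs (fundamentalRep (Fin 2)) a.1 a.2.1.1 a.2.1.2 U *
        zdPlaquetteObs (fundamentalRep (Fin 2)) b.1 b.2.1.1 b.2.1.2 U) * zdPlaquetteObs (fundamentalRep (Fin 2)) c.1 c.2.1.1 c.2.1.2 U,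
        zdPlaquetteObs (fundamentalRep (Fin 2)) e.1 e.2.1.1 e.2.1.2; zdHaar d (Matrix.specialUnitaryGroup (Fin 2) ℂ)]
      - (∫ U, zdPlaquetteObs (fundamentalRep (Fin 2)) a.1 a.2.1.1 a.2.1.2 U *
          zdPlaquetteObs (fundamentalRep (Fin 2)) b.1 b.2.1.1 b.2.1.2 U ∂zdHaar d (Matrix.specialUnitaryGroup (Fin 2) ℂ)) *
        cov[zdPlaquetteObs (fundamentalRep (Fin 2)) c.1 c.2.1.1 c.2.1.2, zdPlaquetteObs (fundamentalRep (Fin 2)) e.1 e.2.1.1 e.2.1.2;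
          zdHaar d (Matrix.specialUnitaryGroup (Fin 2) ℂ)]
      - (∫ U, zdPlaquetteObs (fundamentalRep (Fin 2)) c.1 c.2.1.1 c.2.1.2 U ∂zdHaar d (Matrix.specialUnitaryGroup (Fin 2) ℂ)) *
        cov[fun U => zdPlaquetteObs (fundamentalRep (Fin 2)) a.1 a.2.1.1 a.2.1.2 U *
          zdPlaquetteObs (fundamentalRep (Fin 2)) b.1 b.2.1.1 b.2.1.2 U, zdPlaquetteObs (fundamentalRep (Fin 2)) e.1 e.2.1.1 e.2.1.2;
          zdHaar d (Matrix.specialUnitaryGroup (Fin 2) ℂ)])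
      - cov[zdPlaquetteObs (fundamentalRep (Fin 2)) a.1 a.2.1.1 a.2.1.2, zdPlaquetteObs (fundamentalRep (Fin 2)) e.1 e.2.1.1 e.2.1.2;
          zdHaar d (Matrix.specialUnitaryGroup (Fin 2) ℂ)] *
        cov[zdPlaquetteObs (fundamentalRep (Fin 2)) b.1 b.2.1.1 b.2.1.2, zdPlaquetteObs (fundamentalRep (Fin 2)) c.1 c.2.1.1 c.2.1.2;
          zdHaar d (Matrix.specialUnitaryGroup (Fin 2) ℂ)]
      - (∫ U, zdPlaquetteObs (fundamentalRep (Fin 2)) a.1 a.2.1.1 a.2.1.2 U ∂zdHaar d (Matrix.specialUnitaryGroup (Fin 2) ℂ)) *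
        U₃'[zdPlaquetteObs (fundamentalRep (Fin 2)) b.1 b.2.1.1 b.2.1.2 ; zdPlaquetteObs (fundamentalRep (Fin 2)) c.1 c.2.1.1 c.2.1.2 ;
          zdPlaquetteObs (fundamentalRep (Fin 2)) e.1 e.2.1.1 e.2.1.2 ; zdHaar d (Matrix.specialUnitaryGroup (Fin 2) ℂ)]
      - cov[zdPlaquetteObs (fundamentalRep (Fin 2)) b.1 b.2.1.1 b.2.1.2, zdPlaquetteObs (fundamentalRep (Fin 2)) e.1 e.2.1.1 e.2.1.2;
          zdHaar d (Matrix.specialUnitaryGroup (Fin 2) ℂ)] *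
        cov[zdPlaquetteObs (fundamentalRep (Fin 2)) a.1 a.2.1.1 a.2.1.2, zdPlaquetteObs (fundamentalRep (Fin 2)) c.1 c.2.1.1 c.2.1.2;
          zdHaar d (Matrix.specialUnitaryGroup (Fin 2) ℂ)]
      - (∫ U, zdPlaquetteObs (fundamentalRep (Fin 2)) b.1 b.2.1.1 b.2.1.2 U ∂zdHaar d (Matrix.specialUnitaryGroup (Fin 2) ℂ)) *
        U₃'[zdPlaquetteObs (fundamentalRep (Fin 2)) a.1 a.2.1.1 a.2.1.2 ; zdPlaquetteObs (fundamentalRep (Fin 2)) c.1 c.2.1.1 c.2.1.2 ;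
          zdPlaquetteObs (fundamentalRep (Fin 2)) e.1 e.2.1.1 e.2.1.2 ; zdHaar d (Matrix.specialUnitaryGroup (Fin 2) ℂ)] =
      -(if a = b ∧ a = c ∧ a = e then 1 else 0) / 16 := by
  haveI := Literature.MathematicalPhysics.QuantumLattice.secondCountableTopology_su2
  exact su2_fourPoint_zdHaar (isSpecialUnitaryModel_fundamentalRep 2) a b c e

end Concrete

end Summit.Ventures.YMGap.ZeroCouplingMoments
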